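import Summits.QuantumFields.YangMills.Theorems.QuantileBitPurityGAxisGood
import Summits.QuantumFields.YangMills.Theorems.QuantileBitPuritySectorTranslate
import Summits.QuantumFields.YangMills.Theorems.QuantileBitPuritySectorTwistBound
import Summits.QuantumFields.YangMills.Theorems.ToronSmallBallOwnAxisShiftWindow
import Summits.QuantumFields.YangMills.Theorems.SwapTwistDeficitPolyakovHolonomy
import HarnessLib

/-!
# The seam-axis sheet shift dominates the core of the periodic sector: the periodic-sector core estimate from numeric inequalities

Support module (`--supports` stmt-QuantumFields-23948, `QuantileBitPurity.HolonomyQuantileSubQuartic`; seat ym-dw-p1 g16, plan HOME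
`bc/g15-dw/PLAN-CORE-GAXIS.md`, modules T1 applied + N1).  In the UNTWISTED seam sector of the ring of `n+1` slices:

* §1 ★ `sectorWeight_coreGood_le`: ONE seam-axis sheet shift `gAxisShift θ χ₀ σ₁` (Jacobian exactly `1`, `measurePreserving_gAxisShift`) maps the
  slice-`0` core `{polDist U₀ ≤ r}` into its complement as soon as `2r < (4/3)θ` (`0 ≤ θ ≤ 1`; the `x`-holonomy through the origin is multiplied by
  `h₀` with `vacDist h₀ ≥ (4/3)θ`), so by the transport inequality `TT.sectorWeight_indicator_le_of_translate` and the cost exponent `Q` of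
  `seamDensity_le_exp_mul_gAxisShift`:  `W₀(𝟙_{core ∩ good}) ≤ e^{Q} · W₀(𝟙_{off-core})`;
* §2 bookkeeping: `W₀(𝟙_core) ≤ W₀(𝟙_{core ∩ good}) + W₀(𝟙_{goodᶜ})`, `W₀(𝟙_{off-core}) = W₀(1) − W₀(𝟙_core)`, hence
  `W₀(core) ≤ (e^{Q} + τ)/(1 + e^{Q}) · W₀(1)` whenever the bad fields carry at most `τ · W₀(1)`;
* §3 ★ `sectorWeight_core_le_of_numerics`: with `n + 1 = L`, `θ = 2β^{−2/5}`, `r = β^{−2/5}`, `χ₀ = σ₁ = β^{−1/4}`, `s = η²`, `t = η`, `η = β^{−19/40}`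
  and three numeric inequalities (`Q ≤ 1`, the bad-field inequality of `OwnAxis.ineq_bad`, `θ ≤ 1`) the PERIODIC-SECTOR CORE ESTIMATE holds at
  `(β, L)` with `q₀ = (e + 1/2)/(e + 1)`.

HONEST FRAMING: a fixed-lattice estimate in one seam sector; nothing about infinite volume, the continuum limit or the Clay gap.  No `sorry`, no new
axiom, no new definition.  References: [cite: Luscher1983, §2]; [cite: MontvayMunster1994, (3.145)]; [cite: tHooft1979].
-/

set_option autoImplicit false

noncomputable section

open MeasureTheory Set Function
open scoped BigOperators
open Literature.MathematicalPhysics.QuantumLattice (su2Quat su2Quat_ne_zero norm_su2Quat)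
open Literature.MathematicalPhysics.QuantumFieldTheory hiding su2Quat_mul
open Literature.MathematicalPhysics.QuantumFieldTheory.Balaban1983to89.T4HaarSU2ExpChart (expPoint)

namespace Summit.QuantumFields.YangMills.Theorems.FemtoTransferGap.GAxis

open ClassShift FlatSheet OwnAxis
open Summit.QuantumFields.YangMills.Theorems.FemtoTransferGap.TT

variable {L : ℕ} [NeZero L]

/-! ## §1 One shift dominates the good part of the core by the off-core event -/

/-- ★ **Core domination.**  For `β ≥ 0`, `t ≥ 0`, `χ₀, σ₁ > 0`, `0 ≤ θ ≤ 1` and a core radius `r` with `2r < (4/3)θ`: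
`W₀(𝟙_{goodEvent ∩ {polDist U₀ ≤ r}}) ≤ e^{Q} · W₀(𝟙_{r < polDist U₀})`, `Q` the exponent of `seamDensity_le_exp_mul_gAxisShift`.
[cite: Luscher1983, §2] [cite: MontvayMunster1994, (3.145)] -/
theorem sectorWeight_coreGood_le {β : ℝ} (hβ : 0 ≤ β) (n : ℕ) {s t r θ χ₀ σ₁ : ℝ} (ht : 0 ≤ t) (hχ : 0 < χ₀) (hσ : 0 < σ₁)
    (hθ0 : 0 ≤ θ) (hθ1 : θ ≤ 1) (hrθ : 2 * r < 4 / 3 * θ) :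
    sectorWeight β n (fun _ => false) (fun Us g =>
        {p : (Site 3 L → SU2) × (Fin (n + 1) → GaugeConfig 3 L SU2) | p ∈ goodEvent n (fun _ => false) s t ∧ polDist (p.2 0) ≤ r}.indicator
          (fun _ => (1 : ℝ)) (g, Us)) ≤
      Real.exp (β * ((n + 1 : ℕ) * (Fintype.card (Plaquette 3 L) *
            ((|θ| * (L * ((n + 1 : ℕ) * t) / χ₀ + L * (L * Real.sqrt s) / σ₁ + 2 * σ₁) + 2 * (L * (L * Real.sqrt s)) * |θ| + 2 * (n * t) * |θ|) ^ 2 +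
              2 * (|θ| * (L * ((n + 1 : ℕ) * t) / χ₀ + L * (L * Real.sqrt s) / σ₁ + 2 * σ₁) + 2 * (L * (L * Real.sqrt s)) * |θ| + 2 * (n * t) * |θ|) * Real.sqrt s)) +
          Fintype.card (Edge 3 L) * ((2 * χ₀ * |θ| + 4 * (L * ((n + 1 : ℕ) * t)) * |θ|) ^ 2 + 2 * (2 * χ₀ * |θ| + 4 * (L * ((n + 1 : ℕ) * t)) * |θ|) * t))) *
      sectorWeight β n (fun _ => false) (fun Us g =>
        {p : (Site 3 L → SU2) × (Fin (n + 1) → GaugeConfig 3 L SU2) | r < polDist (p.2 0)}.indicator (fun _ => (1 : ℝ)) (g, Us)) := by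
  have hproj : Measurable fun p : (Site 3 L → SU2) × (Fin (n + 1) → GaugeConfig 3 L SU2) => p.2 0 := (measurable_pi_apply 0).comp measurable_snd
  have hpd : Measurable fun p : (Site 3 L → SU2) × (Fin (n + 1) → GaugeConfig 3 L SU2) => polDist (p.2 0) := measurable_polDist.comp hproj
  have hA : MeasurableSet {p : (Site 3 L → SU2) × (Fin (n + 1) → GaugeConfig 3 L SU2) | p ∈ goodEvent n (fun _ => false) s t ∧ polDist (p.2 0) ≤ r} := by
    have h1 : MeasurableSet {p : (Site 3 L → SU2) × (Fin (n + 1) → GaugeConfig 3 L SU2) | p ∈ goodEvent n (fun _ => false) s t} :=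
      measurableSet_goodEvent (L := L) n _ s t
    have h2 : MeasurableSet {p : (Site 3 L → SU2) × (Fin (n + 1) → GaugeConfig 3 L SU2) | polDist (p.2 0) ≤ r} := measurableSet_le hpd measurable_const
    rw [measurableSet_setOf] at h1 h2 ⊢
    exact h1.and h2
  have hB : MeasurableSet {p : (Site 3 L → SU2) × (Fin (n + 1) → GaugeConfig 3 L SU2) | r < polDist (p.2 0)} := measurableSet_lt measurable_const hpd
  refine sectorWeight_indicator_le_of_translate (L := L) β n (fun _ => false) (measurable_gAxisShift_uncurry θ χ₀ σ₁ n)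
    (fun g => measurePreserving_gAxisShift θ χ₀ σ₁ g n) hA hB ?_ (Real.exp_pos _).le ?_
  · -- the image leaves the core
    rintro p ⟨-, hcore⟩
    simp only [Set.mem_setOf_eq, gAxisShift_apply]
    have h1 := abs_polDist_siteTwist_zero_sub_le (gAxisField θ χ₀ σ₁ p.1 (p.2 0)) (p.2 0)
    rw [gAxisField_zero] at h1
    have h2 := vacDist_gAxisElt_ge hθ0 hθ1 hχ hσ p.1 (p.2 0)
    have h3 := (abs_le.1 h1).1
    linarith
  · -- the cost
    rintro p ⟨hgood, -⟩
    exact seamDensity_le_exp_mul_gAxisShift hβ θ hχ hσ ht hgood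

/-! ## §2 Bookkeeping -/

/-- `W₀(𝟙_core) ≤ W₀(𝟙_{good ∩ core}) + W₀(𝟙_{goodᶜ})`. [folklore] -/
theorem sectorWeight_core_le_add (β : ℝ) (n : ℕ) (s t r : ℝ) :
    sectorWeight β n (fun _ => false) (fun Us _ => {U : GaugeConfig 3 L SU2 | polDist U ≤ r}.indicator (fun _ => (1 : ℝ)) (Us 0)) ≤
      sectorWeight β n (fun _ => false) (fun Us g =>
          {p : (Site 3 L → SU2) × (Fin (n + 1) → GaugeConfig 3 L SU2) | p ∈ goodEvent n (fun _ => false) s t ∧ polDist (p.2 0) ≤ r}.indicator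
            (fun _ => (1 : ℝ)) (g, Us)) +
        sectorWeight β n (fun _ => false) (fun Us g => (goodEvent (L := L) n (fun _ => false) s t)ᶜ.indicator (fun _ => (1 : ℝ)) (g, Us)) := by
  have hproj : Measurable fun p : (Site 3 L → SU2) × (Fin (n + 1) → GaugeConfig 3 L SU2) => p.2 0 := (measurable_pi_apply 0).comp measurable_snd
  have hpd : Measurable fun p : (Site 3 L → SU2) × (Fin (n + 1) → GaugeConfig 3 L SU2) => polDist (p.2 0) := measurable_polDist.comp hproj
  have hswap : Measurable fun q : (Fin (n + 1) → GaugeConfig 3 L SU2) × (Site 3 L → SU2) => (q.2, q.1) := measurable_snd.prodMk measurable_fst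
  have hcoreU : MeasurableSet {U : GaugeConfig 3 L SU2 | polDist U ≤ r} := measurableSet_le measurable_polDist measurable_const
  have hG : MeasurableSet (goodEvent (L := L) n (fun _ => false) s t) := measurableSet_goodEvent (L := L) n _ s t
  have hA : MeasurableSet {p : (Site 3 L → SU2) × (Fin (n + 1) → GaugeConfig 3 L SU2) | p ∈ goodEvent n (fun _ => false) s t ∧ polDist (p.2 0) ≤ r} := by
    have h2 : MeasurableSet {p : (Site 3 L → SU2) × (Fin (n + 1) → GaugeConfig 3 L SU2) | polDist (p.2 0) ≤ r} := measurableSet_le hpd measurable_const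
    have h1 : MeasurableSet {p : (Site 3 L → SU2) × (Fin (n + 1) → GaugeConfig 3 L SU2) | p ∈ goodEvent n (fun _ => false) s t} := hG
    rw [measurableSet_setOf] at h1 h2 ⊢
    exact h1.and h2
  -- measurability / bounds of the three functionals
  have hFm : Measurable (uncurry fun (Us : Fin (n + 1) → GaugeConfig 3 L SU2) (_ : Site 3 L → SU2) =>
      {U : GaugeConfig 3 L SU2 | polDist U ≤ r}.indicator (fun _ => (1 : ℝ)) (Us 0)) :=
    (measurable_const.indicator hcoreU).comp ((measurable_pi_apply 0).comp measurable_fst)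
  have hAm : Measurable (uncurry fun (Us : Fin (n + 1) → GaugeConfig 3 L SU2) (g : Site 3 L → SU2) =>
      {p : (Site 3 L → SU2) × (Fin (n + 1) → GaugeConfig 3 L SU2) | p ∈ goodEvent n (fun _ => false) s t ∧ polDist (p.2 0) ≤ r}.indicator
        (fun _ => (1 : ℝ)) (g, Us)) := (measurable_const.indicator hA).comp hswap
  have hCm : Measurable (uncurry fun (Us : Fin (n + 1) → GaugeConfig 3 L SU2) (g : Site 3 L → SU2) =>
      (goodEvent (L := L) n (fun _ => false) s t)ᶜ.indicator (fun _ => (1 : ℝ)) (g, Us)) := (measurable_const.indicator hG.compl).comp hswap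
  have hsum := sectorWeight_add (L := L) β n (fun _ => false) hAm hCm (C := 1) (fun Us g => abs_indicator_one_le _ _) (fun Us g => abs_indicator_one_le _ _)
  rw [← hsum]
  refine sectorWeight_mono (L := L) β n (fun _ => false) hFm (hAm.add hCm) (C := 2)
    (fun Us g => (abs_indicator_one_le _ _).trans (by norm_num)) (fun Us g => (abs_add_le _ _).trans ?_) fun Us g => ?_
  · have := abs_indicator_one_le ({p : (Site 3 L → SU2) × (Fin (n + 1) → GaugeConfig 3 L SU2) | p ∈ goodEvent n (fun _ => false) s t ∧ polDist (p.2 0) ≤ r}) (g, Us)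
    have := abs_indicator_one_le ((goodEvent (L := L) n (fun _ => false) s t)ᶜ) (g, Us)
    linarith
  · by_cases hc : polDist (Us 0) ≤ r
    · rw [Set.indicator_of_mem (show Us 0 ∈ {U : GaugeConfig 3 L SU2 | polDist U ≤ r} from hc)]
      by_cases hg : (g, Us) ∈ goodEvent (L := L) n (fun _ => false) s t
      · rw [Set.indicator_of_mem (show ((g, Us) : (Site 3 L → SU2) × (Fin (n + 1) → GaugeConfig 3 L SU2)) ∈
            {p : (Site 3 L → SU2) × (Fin (n + 1) → GaugeConfig 3 L SU2) | p ∈ goodEvent n (fun _ => false) s t ∧ polDist (p.2 0) ≤ r} from ⟨hg, hc⟩)]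
        have h0 := Set.indicator_nonneg (fun _ _ => zero_le_one (α := ℝ)) (s := (goodEvent (L := L) n (fun _ => false) s t)ᶜ) (g, Us)
        linarith
      · rw [Set.indicator_of_mem (show ((g, Us) : (Site 3 L → SU2) × (Fin (n + 1) → GaugeConfig 3 L SU2)) ∈ (goodEvent (L := L) n (fun _ => false) s t)ᶜ from hg)]
        have h0 := Set.indicator_nonneg (fun _ _ => zero_le_one (α := ℝ))
          (s := {p : (Site 3 L → SU2) × (Fin (n + 1) → GaugeConfig 3 L SU2) | p ∈ goodEvent n (fun _ => false) s t ∧ polDist (p.2 0) ≤ r}) (g, Us)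
        linarith
    · rw [Set.indicator_of_notMem (show Us 0 ∉ {U : GaugeConfig 3 L SU2 | polDist U ≤ r} from hc)]
      exact add_nonneg (Set.indicator_nonneg (fun _ _ => zero_le_one) _) (Set.indicator_nonneg (fun _ _ => zero_le_one) _)

/-- `W₀(𝟙_{r < polDist}) = W₀(1) − W₀(𝟙_{polDist ≤ r})`. [folklore] -/
theorem sectorWeight_offCore_eq (β : ℝ) (n : ℕ) (r : ℝ) :
    sectorWeight β n (fun _ => false) (fun Us g =>
        {p : (Site 3 L → SU2) × (Fin (n + 1) → GaugeConfig 3 L SU2) | r < polDist (p.2 0)}.indicator (fun _ => (1 : ℝ)) (g, Us)) =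
      sectorWeight (L := L) β n (fun _ => false) (fun _ _ => (1 : ℝ)) -
        sectorWeight β n (fun _ => false) (fun Us _ => {U : GaugeConfig 3 L SU2 | polDist U ≤ r}.indicator (fun _ => (1 : ℝ)) (Us 0)) := by
  have hproj : Measurable fun p : (Site 3 L → SU2) × (Fin (n + 1) → GaugeConfig 3 L SU2) => p.2 0 := (measurable_pi_apply 0).comp measurable_snd
  have hpd : Measurable fun p : (Site 3 L → SU2) × (Fin (n + 1) → GaugeConfig 3 L SU2) => polDist (p.2 0) := measurable_polDist.comp hproj
  have hswap : Measurable fun q : (Fin (n + 1) → GaugeConfig 3 L SU2) × (Site 3 L → SU2) => (q.2, q.1) := measurable_snd.prodMk measurable_fst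
  have hcoreU : MeasurableSet {U : GaugeConfig 3 L SU2 | polDist U ≤ r} := measurableSet_le measurable_polDist measurable_const
  have hB : MeasurableSet {p : (Site 3 L → SU2) × (Fin (n + 1) → GaugeConfig 3 L SU2) | r < polDist (p.2 0)} := measurableSet_lt measurable_const hpd
  have hFm : Measurable (uncurry fun (Us : Fin (n + 1) → GaugeConfig 3 L SU2) (_ : Site 3 L → SU2) =>
      {U : GaugeConfig 3 L SU2 | polDist U ≤ r}.indicator (fun _ => (1 : ℝ)) (Us 0)) :=
    (measurable_const.indicator hcoreU).comp ((measurable_pi_apply 0).comp measurable_fst)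
  have hBm : Measurable (uncurry fun (Us : Fin (n + 1) → GaugeConfig 3 L SU2) (g : Site 3 L → SU2) =>
      {p : (Site 3 L → SU2) × (Fin (n + 1) → GaugeConfig 3 L SU2) | r < polDist (p.2 0)}.indicator (fun _ => (1 : ℝ)) (g, Us)) :=
    (measurable_const.indicator hB).comp hswap
  have hsum := sectorWeight_add (L := L) β n (fun _ => false) hBm hFm (C := 1) (fun Us g => abs_indicator_one_le _ _) (fun Us g => abs_indicator_one_le _ _)
  have hone : (fun (Us : Fin (n + 1) → GaugeConfig 3 L SU2) (g : Site 3 L → SU2) =>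
      {p : (Site 3 L → SU2) × (Fin (n + 1) → GaugeConfig 3 L SU2) | r < polDist (p.2 0)}.indicator (fun _ => (1 : ℝ)) (g, Us) +
        {U : GaugeConfig 3 L SU2 | polDist U ≤ r}.indicator (fun _ => (1 : ℝ)) (Us 0)) = fun _ _ => (1 : ℝ) := by
    funext Us g
    by_cases hc : polDist (Us 0) ≤ r
    · rw [Set.indicator_of_mem (show Us 0 ∈ {U : GaugeConfig 3 L SU2 | polDist U ≤ r} from hc),
        Set.indicator_of_notMem (show ((g, Us) : (Site 3 L → SU2) × (Fin (n + 1) → GaugeConfig 3 L SU2)) ∉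
          {p : (Site 3 L → SU2) × (Fin (n + 1) → GaugeConfig 3 L SU2) | r < polDist (p.2 0)} from fun h => by
            simp only [Set.mem_setOf_eq] at h; linarith)]
      ring
    · rw [Set.indicator_of_notMem (show Us 0 ∉ {U : GaugeConfig 3 L SU2 | polDist U ≤ r} from hc),
        Set.indicator_of_mem (show ((g, Us) : (Site 3 L → SU2) × (Fin (n + 1) → GaugeConfig 3 L SU2)) ∈
          {p : (Site 3 L → SU2) × (Fin (n + 1) → GaugeConfig 3 L SU2) | r < polDist (p.2 0)} from by
            simp only [Set.mem_setOf_eq]; exact lt_of_not_ge hc)]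
      ring
  rw [hone] at hsum
  linarith

/-- **Algebra of the conclusion**: `W_c ≤ C (W₁ − W_c) + τ W₁` with `C ≥ 0` gives `W_c ≤ (C + τ)/(1 + C) · W₁`. [folklore] -/
theorem core_fraction_le {Wc W1 C τ : ℝ} (hC : 0 ≤ C) (h : Wc ≤ C * (W1 - Wc) + τ * W1) : Wc ≤ (C + τ) / (1 + C) * W1 := by
  rw [div_mul_eq_mul_div, le_div_iff₀ (by linarith)]
  nlinarith

/-- The fraction `(C + τ)/(1 + C)` is monotone in `C` when `τ ≤ 1`. [folklore] -/
theorem fraction_mono {C C' τ : ℝ} (hC : 0 ≤ C) (hCC : C ≤ C') (hτ : τ ≤ 1) : (C + τ) / (1 + C) ≤ (C' + τ) / (1 + C') := by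
  rw [div_le_div_iff₀ (by linarith) (by linarith)]
  nlinarith

/-! ## §3 The periodic-sector core estimate at fixed `β`, `L` from numeric inequalities -/

/-- Monotonicity of `x ↦ x² + 2xε` on `x ≥ 0`. [folklore] -/
theorem sq_add_mono {x y ε : ℝ} (hx : 0 ≤ x) (hxy : x ≤ y) (hε : 0 ≤ ε) : x ^ 2 + 2 * x * ε ≤ y ^ 2 + 2 * y * ε := by nlinarith

set_option maxHeartbeats 800000 in
/-- ★ **The periodic-sector core estimate at fixed `β`, `L` from numeric inequalities.**  With `θ = 2β^{−2/5}`, `r = β^{−2/5}`, `χ = β^{−1/4}`,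
`η = β^{−19/40}`, ring length `L` (`n = L − 1`, `L ≥ 2`), if `200 ≤ β`, `θ ≤ 1`, the simplified cost exponent is `≤ 1` and the bad-field inequality
holds, then `W₀(𝟙{polDist U₀ ≤ β^{−2/5}}) ≤ ((e + 1/2)/(e + 1)) · W₀(1)`. [cite: Luscher1983, §2] [cite: MontvayMunster1994, (3.145)] -/
theorem sectorWeight_core_le_of_numerics {β a : ℝ} (hβ : 200 ≤ β) (hL2 : 2 ≤ L)
    (hθ1 : 2 * β ^ (-(2 / 5 : ℝ)) ≤ 1)
    (hQ : 3 * β * (L : ℝ) ^ 4 *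
        (((2 * β ^ (-(2 / 5 : ℝ))) * (2 * (L * (L * β ^ (-(19 / 40 : ℝ)))) / β ^ (-(1 / 4 : ℝ)) + 2 * β ^ (-(1 / 4 : ℝ)) +
              2 * (L * (L * β ^ (-(19 / 40 : ℝ)))) + 2 * (L * β ^ (-(19 / 40 : ℝ))))) ^ 2 +
          2 * ((2 * β ^ (-(2 / 5 : ℝ))) * (2 * (L * (L * β ^ (-(19 / 40 : ℝ)))) / β ^ (-(1 / 4 : ℝ)) + 2 * β ^ (-(1 / 4 : ℝ)) +
              2 * (L * (L * β ^ (-(19 / 40 : ℝ)))) + 2 * (L * β ^ (-(19 / 40 : ℝ))))) * β ^ (-(19 / 40 : ℝ)) +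
          ((2 * β ^ (-(2 / 5 : ℝ))) * (2 * β ^ (-(1 / 4 : ℝ)) + 4 * (L * (L * β ^ (-(19 / 40 : ℝ)))))) ^ 2 +
          2 * ((2 * β ^ (-(2 / 5 : ℝ))) * (2 * β ^ (-(1 / 4 : ℝ)) + 4 * (L * (L * β ^ (-(19 / 40 : ℝ)))))) * β ^ (-(19 / 40 : ℝ))) ≤ 1)
    (hG : 4 * (L : ℝ) * Real.exp (-(β * (β ^ (-(19 / 40 : ℝ))) ^ 2 / 2)) * (β ^ (315 * L ^ 3)) ^ (2 * L) ≤ β ^ (-a) / 2)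
    (ha : 0 ≤ a) :
    sectorWeight β (L - 1) (fun _ => false) (fun Us _ =>
        {U : GaugeConfig 3 L SU2 | polDist U ≤ β ^ (-(2 / 5 : ℝ))}.indicator (fun _ => (1 : ℝ)) (Us 0)) ≤
      (Real.exp 1 + 1 / 2) / (Real.exp 1 + 1) * sectorWeight (L := L) β (L - 1) (fun _ => false) (fun _ _ => (1 : ℝ)) := by
  have hL1 : 1 ≤ L := le_trans (by norm_num) hL2
  have hLr : (1 : ℝ) ≤ L := by exact_mod_cast hL1
  have hβ0 : 0 < β := by linarith
  have hβ1 : 1 ≤ β := by linarith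
  set n : ℕ := L - 1 with hn
  have hn1 : 1 ≤ n := by omega
  have hnL : n + 1 = L := by omega
  have hnr : ((n : ℕ) : ℝ) = L - 1 := by
    have : ((n : ℕ) : ℝ) + 1 = L := by exact_mod_cast hnL
    linarith
  have hn1r : (((n + 1 : ℕ)) : ℝ) = L := by exact_mod_cast hnL
  -- parameters
  set θ : ℝ := 2 * β ^ (-(2 / 5 : ℝ)) with hθ
  set r : ℝ := β ^ (-(2 / 5 : ℝ)) with hr
  set χ : ℝ := β ^ (-(1 / 4 : ℝ)) with hχ
  set η : ℝ := β ^ (-(19 / 40 : ℝ)) with hη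
  have hr0 : 0 < r := Real.rpow_pos_of_pos hβ0 _
  have hθ0 : 0 ≤ θ := by positivity
  have hχ0 : 0 < χ := Real.rpow_pos_of_pos hβ0 _
  have hη0 : 0 < η := Real.rpow_pos_of_pos hβ0 _
  have hrθ : 2 * r < 4 / 3 * θ := by rw [hθ]; linarith
  have hθabs : |θ| = θ := abs_of_nonneg hθ0
  have hsq : Real.sqrt (η ^ 2) = η := Real.sqrt_sq hη0.le
  -- §1 with these parameters
  have hdom := sectorWeight_coreGood_le (L := L) hβ0.le n (s := η ^ 2) (t := η) hη0.le hχ0 hχ0 hθ0 hθ1 hrθ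
  -- the exponent is at most `1`
  set D : ℝ := |θ| * (L * ((n + 1 : ℕ) * η) / χ + L * (L * Real.sqrt (η ^ 2)) / χ + 2 * χ) + 2 * (L * (L * Real.sqrt (η ^ 2))) * |θ| + 2 * (n * η) * |θ| with hD
  set Dg : ℝ := 2 * χ * |θ| + 4 * (L * ((n + 1 : ℕ) * η)) * |θ| with hDg
  set Ds : ℝ := θ * (2 * (L * (L * η)) / χ + 2 * χ + 2 * (L * (L * η)) + 2 * (L * η)) with hDs
  set Dgs : ℝ := θ * (2 * χ + 4 * (L * (L * η))) with hDgs
  have hD0 : 0 ≤ D := by rw [hD]; positivity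
  have hDg0 : 0 ≤ Dg := by rw [hDg]; positivity
  have hDDs : D ≤ Ds := by
    rw [hD, hDs, hθabs, hsq, hn1r, hnr]
    have h1 : (L : ℝ) * (L * η) / χ + L * (L * η) / χ + 2 * χ = 2 * (L * (L * η)) / χ + 2 * χ := by ring
    have h2 : 2 * ((L - 1) * η) * θ ≤ 2 * (L * η) * θ := by nlinarith [hη0.le, hθ0]
    nlinarith [h2, hη0.le, hθ0, hχ0.le]
  have hDgDgs : Dg = Dgs := by rw [hDg, hDgs, hθabs, hn1r]; ring
  have hexp_le : β * ((n + 1 : ℕ) * (Fintype.card (Plaquette 3 L) * (D ^ 2 + 2 * D * Real.sqrt (η ^ 2))) +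
      Fintype.card (Edge 3 L) * (Dg ^ 2 + 2 * Dg * η)) ≤ 1 := by
    rw [hsq, hn1r]
    have hP3 : (Fintype.card (Plaquette 3 L) : ℝ) = 3 * (L : ℝ) ^ 3 := by
      have h := card_plaquette_add_card_edge_mul (L := L) (1 : ℝ)
      have hE : (Fintype.card (Edge 3 L) : ℝ) = 3 * (L : ℝ) ^ 3 := by exact_mod_cast (card_edge_three (L := L))
      rw [hE] at h; linarith
    have hE3 : (Fintype.card (Edge 3 L) : ℝ) = 3 * (L : ℝ) ^ 3 := by exact_mod_cast (card_edge_three (L := L))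
    rw [hP3, hE3]
    have hb1 : D ^ 2 + 2 * D * η ≤ Ds ^ 2 + 2 * Ds * η := sq_add_mono hD0 hDDs hη0.le
    have hb2 : Dg ^ 2 + 2 * Dg * η = Dgs ^ 2 + 2 * Dgs * η := by rw [hDgDgs]
    have hDs0 : 0 ≤ Ds ^ 2 + 2 * Ds * η := by have : 0 ≤ Ds := hD0.trans hDDs; positivity
    have hDgs0 : 0 ≤ Dgs ^ 2 + 2 * Dgs * η := by rw [← hb2]; positivity
    calc β * ((L : ℝ) * (3 * (L : ℝ) ^ 3 * (D ^ 2 + 2 * D * η)) + 3 * (L : ℝ) ^ 3 * (Dg ^ 2 + 2 * Dg * η))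
        ≤ β * ((L : ℝ) * (3 * (L : ℝ) ^ 3 * (Ds ^ 2 + 2 * Ds * η)) + (L : ℝ) * (3 * (L : ℝ) ^ 3 * (Dgs ^ 2 + 2 * Dgs * η))) := by
          rw [hb2]
          refine mul_le_mul_of_nonneg_left (add_le_add ?_ ?_) hβ0.le
          · exact mul_le_mul_of_nonneg_left (mul_le_mul_of_nonneg_left hb1 (by positivity)) (by positivity)
          · exact le_mul_of_one_le_left (by positivity) hLr
      _ = 3 * β * (L : ℝ) ^ 4 * (Ds ^ 2 + 2 * Ds * η + Dgs ^ 2 + 2 * Dgs * η) := by ring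
      _ ≤ 1 := by rw [hDs, hDgs]; exact hQ
  have hC : Real.exp (β * ((n + 1 : ℕ) * (Fintype.card (Plaquette 3 L) * (D ^ 2 + 2 * D * Real.sqrt (η ^ 2))) +
      Fintype.card (Edge 3 L) * (Dg ^ 2 + 2 * Dg * η))) ≤ Real.exp 1 := Real.exp_le_exp.2 hexp_le
  -- the bad fields carry at most `1/2 · W₀(1)`
  have hZle : physTraceSucc L β n ≤ sectorWeight (L := L) β n (fun _ => false) (fun _ _ => (1 : ℝ)) := by
    obtain ⟨m, hm⟩ : ∃ m : ℕ, n = m + 1 := ⟨n - 1, by omega⟩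
    rw [hm]; exact physTraceSucc_le_sectorWeight_untwisted (L := L) hβ0.le m
  have hZ0 : 0 ≤ physTraceSucc L β n := by
    have h := floor_le_physTraceSucc (L := L) hn1 (by linarith) (floor_const_le.trans hβ)
    exact le_trans (by positivity) h
  have hbad := sectorWeight_indicator_compl_goodEvent_le_floor (L := L) hn1 (by linarith) (floor_const_le.trans hβ) (fun _ => false) (η ^ 2) hη0.le
  have hpow : (β ^ (8 * Fintype.card (Plaquette 3 L) + 97 * Fintype.card (Edge 3 L))) ^ (n + 1) = (β ^ (315 * L ^ 3)) ^ L := by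
    rw [badExponent_eq, hnL]
  have hpow2 : (β ^ (315 * L ^ 3)) ^ L ≤ (β ^ (315 * L ^ 3)) ^ (2 * L) :=
    pow_le_pow_right₀ (one_le_pow₀ hβ1) (by omega)
  have hn' : ((n : ℝ) + 1) = L := by exact_mod_cast hnL
  have hτ : sectorWeight β n (fun _ => false) (fun Us g => (goodEvent (L := L) n (fun _ => false) (η ^ 2) η)ᶜ.indicator (fun _ => (1 : ℝ)) (g, Us)) ≤
      1 / 2 * sectorWeight (L := L) β n (fun _ => false) (fun _ _ => (1 : ℝ)) := by
    refine hbad.trans ?_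
    rw [hpow, hn', show β / 2 * η ^ 2 = β * η ^ 2 / 2 by ring]
    have hβa : β ^ (-a) ≤ 1 := Real.rpow_le_one_of_one_le_of_nonpos hβ1 (by linarith)
    set E : ℝ := Real.exp (-(β * η ^ 2 / 2)) with hE
    set P : ℝ := β ^ (315 * L ^ 3) with hP
    have hE0 : 0 ≤ (L : ℝ) * E := by positivity
    have hP0 : 0 ≤ P ^ (2 * L) := by positivity
    have hstep : (L : ℝ) * (E + E) * P ^ L ≤ 4 * L * E * P ^ (2 * L) := by
      have h1 : (L : ℝ) * (E + E) * P ^ L = 2 * ((L : ℝ) * E) * P ^ L := by ring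
      have h2 : 2 * ((L : ℝ) * E) * P ^ L ≤ 2 * ((L : ℝ) * E) * P ^ (2 * L) := mul_le_mul_of_nonneg_left hpow2 (by positivity)
      have h3 : 0 ≤ (L : ℝ) * E * P ^ (2 * L) := mul_nonneg hE0 hP0
      rw [h1]; linarith
    have hfin : (L : ℝ) * (E + E) * P ^ L * physTraceSucc L β n ≤ 1 / 2 * sectorWeight (L := L) β n (fun _ => false) (fun _ _ => (1 : ℝ)) := by
      have h1 : (L : ℝ) * (E + E) * P ^ L * physTraceSucc L β n ≤ (4 * L * E * P ^ (2 * L)) * physTraceSucc L β n :=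
        mul_le_mul_of_nonneg_right hstep hZ0
      have h2 : (4 * L * E * P ^ (2 * L)) * physTraceSucc L β n ≤ β ^ (-a) / 2 * physTraceSucc L β n := mul_le_mul_of_nonneg_right hG hZ0
      have h3 : β ^ (-a) / 2 * physTraceSucc L β n ≤ 1 / 2 * physTraceSucc L β n := by
        refine mul_le_mul_of_nonneg_right ?_ hZ0; linarith
      have h4 : 1 / 2 * physTraceSucc L β n ≤ 1 / 2 * sectorWeight (L := L) β n (fun _ => false) (fun _ _ => (1 : ℝ)) := by linarith
      linarith
    exact hfin
  -- assemble
  have hsplit := sectorWeight_core_le_add (L := L) β n (η ^ 2) η r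
  have hoff := sectorWeight_offCore_eq (L := L) β n r
  set Wc := sectorWeight β n (fun _ => false) (fun Us _ => {U : GaugeConfig 3 L SU2 | polDist U ≤ r}.indicator (fun _ => (1 : ℝ)) (Us 0)) with hWc
  set W1 := sectorWeight (L := L) β n (fun _ => false) (fun _ _ => (1 : ℝ)) with hW1
  set C := Real.exp (β * ((n + 1 : ℕ) * (Fintype.card (Plaquette 3 L) * (D ^ 2 + 2 * D * Real.sqrt (η ^ 2))) +
      Fintype.card (Edge 3 L) * (Dg ^ 2 + 2 * Dg * η))) with hCdef
  have hC0 : 0 ≤ C := (Real.exp_pos _).le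
  rw [hoff] at hdom
  have hmain : Wc ≤ C * (W1 - Wc) + 1 / 2 * W1 := hsplit.trans (add_le_add hdom hτ)
  have hfrac := core_fraction_le hC0 hmain
  have hW10 : 0 ≤ W1 := sectorWeight_nonneg β n _ fun _ _ => zero_le_one
  calc Wc ≤ (C + 1 / 2) / (1 + C) * W1 := hfrac
    _ ≤ (Real.exp 1 + 1 / 2) / (1 + Real.exp 1) * W1 := mul_le_mul_of_nonneg_right (fraction_mono hC0 hC (by norm_num)) hW10
    _ = (Real.exp 1 + 1 / 2) / (Real.exp 1 + 1) * W1 := by rw [add_comm 1 (Real.exp 1)]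

end Summit.QuantumFields.YangMills.Theorems.FemtoTransferGap.GAxis

end
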